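import Summits.ResolutionOfSingularities.ResolutionOfSingularities.Theorems.ValuativePatchingRelDimThreeFormat
import Summits.ResolutionOfSingularities.ResolutionOfSingularities.Theorems.PAlterationPicoverLocalBlowups
import Literature.AlgebraicGeometry.Resolution.Temkin2008Localization
import Literature.AlgebraicGeometry.Resolution.ExcellentRingsCompleteHolds
import Literature.AlgebraicGeometry.Resolution.BlowupDimension
import Literature.AlgebraicGeometry.Resolution.BlowupsIntegral
import Literature.AlgebraicGeometry.Resolution.BlowupsProperProofs
import Literature.AlgebraicGeometry.Resolution.MacaulayficationProjectiveReduction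
import Literature.AlgebraicGeometry.Motives.AbelianVarietyIsogenyProofs
import HarnessLib

/-!
# Crux `PatchingRelPerfect` (stmt-ResolutionOfSingularities-16161), line `closed-point-slice`
# (skeleton v3): stub `stub_atomDimLeThree` — the punctual atom over complete regular local
# bases of dimension `≤ 3`

Route `ResolutionOfSingularities/FrobeniusClosing`, crux #6 `PatchingRelPerfect`. Skeleton v3 of
the line splits the atom `PunctualCompletePerfect p 4` (punctual resolution in single-blow-up
format over a COMPLETE regular local base `S` of dimension `≤ 4`, characteristic `p`, perfect
residue field) by the dimension of the base. This file proves the registered stub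
`stub_atomDimLeThree`, verbatim: the part `dim S ≤ 3`, which is TRUE modulo the printed inputs
carried as hypotheses — Cossart–Piltant 2019, Thm. 1.1 (`CossartPiltant2019General`) and Prop. 4.4
(`CossartPiltant2019Principalization`), and Cossart–Jannsen–Saito 2020, Thm. 1.2 in Temkin's
desingularization format (`hCJS`).

## Proof

Let `f : T → Spec S` be proper and birational, `T` integral, regular off the closed fibre.

* `T` is Noetherian and separated (proper over the Noetherian affine base), and EXCELLENT: a
  complete Noetherian local ring is excellent (`isExcellentRing_of_isAdicComplete`, Stacks 07QW,
  proved in the tree) and `T` is locally of finite type over it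
  (`Picover.LocalBlowups.isExcellent_of_locallyOfFiniteType_of_isExcellentRing`, Matsumura §32).
* `dim T ≤ dim S ≤ 3` (`topologicalKrullDim_le_of_isProper_of_isBirational`): by Raynaud–Gruson
  (Stacks 081T, tree `exists_isBlowup_dominating`) `T` is dominated by a blowing up
  `X' = Bl_I (Spec S)` through a morphism `r : X' → T` which is itself a blowing up of `T` along
  the non-zero ideal `I𝒪_T`, hence proper and surjective, so `dim T ≤ dim X'` (chains of
  specialisations lift along closed surjections,
  `Motives.Scheme.topologicalKrullDim_le_of_universallyClosed_of_surjective`) and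
  `dim X' ≤ dim S` (blowing up does not raise dimension, `IsBlowup.topologicalKrullDim_le`,
  Matsumura Thm. 15.5).
* Singular points of `T` lie over the closed point of `S` (contrapositive of `hoff`).
* If `dim T ≤ 2`: `hCJS` gives a blowing up `π : T' → T` along `J` with `V(J) ⊆ Sing T` and `T'`
  regular; `J ≠ 0` because the generic point of `T` is regular (`genericPoint_mem_regularLocus`).
* If `dim T = 3`: Cossart–Piltant Thm. 1.1 gives a strong resolution `φ : Y → T`, an
  isomorphism over the open `W = Reg T ∋ ξ_T`; `Y` is integral, Noetherian, excellent (of finite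
  type over `S` through `φ ≫ f`) and of dimension EXACTLY `3` (`≤ 3` as a proper birational
  `S`-scheme, `≥ dim T = 3` because `φ` is proper and surjective). So Prop. 4.4 in blow-up
  format (`formatPrincipalization_dim3_of_cossartPiltant`) is Axiom 4 on `Y`, and the twin
  crux's format upgrade `exists_isBlowup_supported_isRegular_of_isIso_over` (Raynaud–Gruson
  domination, Stacks 080A backwards, Temkin's Lemma 2.1.4) yields ONE non-zero blowing up of `T`
  cosupported in `T ∖ W = Sing T ⊆` closed fibre, with regular source.

The hypotheses `CharP S p`, `PerfectField (ResidueField S)` and `p.Prime` are not used below the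
frontier (they are kept for the registered signature; the open core `dim S = 4` needs them).

## Sources

* V. Cossart, O. Piltant, *Resolution of singularities of arithmetical threefolds*, J. Algebra
  529 (2019) 268–535, Thm. 1.1 and Prop. 4.4. [CossartPiltant2019]
* V. Cossart, U. Jannsen, S. Saito, *Desingularization: invariants and strategy — application
  to dimension 2*, Lecture Notes in Math. 2270 (2020), Thm. 1.2. [CossartJannsenSaito2020]
* M. Temkin, *Desingularization of quasi-excellent schemes in characteristic zero*, Adv. Math.
  219 (2008) 488–522, Def. 2.2.6, Lemma 2.1.4. [Temkin2008]
* H. Matsumura, *Commutative Ring Theory*, CUP 1986, Thm. 15.5, §32 p. 260. [Matsumura1987]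
* The Stacks Project, Tags 081T, 07QW. [StacksProject]
-/

set_option linter.dupNamespace false -- single-problem summit: doubled namespace component is forced

noncomputable section

open CategoryTheory CategoryTheory.Limits AlgebraicGeometry Literature.AlgebraicGeometry
open Literature.AlgebraicGeometry.Resolution

namespace Summit.ResolutionOfSingularities.ResolutionOfSingularities.Theorems

universe u

/-- **A proper birational scheme over an integral Noetherian base has no larger dimension**:
if `f : T → X` is proper and birational, `X` integral Noetherian and `dim X ≤ n`, then
`dim T ≤ n`. By Raynaud–Gruson (Stacks 081T, tree `exists_isBlowup_dominating`) `T` is dominated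
by a blowing up `b : X' = Bl_I X → X`, `V(I) = X ∖ U` for the dense open `U` over which `f` is an
isomorphism, through a morphism `r : X' → T` which is itself the blowing up of `T` along the
non-zero ideal `I𝒪_T`, hence proper and surjective; so `dim T ≤ dim X'` (chains of
specialisations lift along closed surjections) and `dim X' ≤ dim X ≤ n` (blowing up does not
raise the dimension, Matsumura Thm. 15.5). [cite: StacksProject, Tag 081T]
[cite: Matsumura1987, Thm. 15.5] -/
theorem topologicalKrullDim_le_of_isProper_of_isBirational {T X : Scheme.{u}} [IsIntegral X]
    [IsNoetherian X] [IsIntegral T] (f : T ⟶ X) [IsProper f] (hbir : IsBirational f) {n : ℕ}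
    (hX : topologicalKrullDim X ≤ n) : topologicalKrullDim T ≤ n := by
  haveI : IsLocallyNoetherian T := LocallyOfFiniteType.isLocallyNoetherian f
  obtain ⟨U, -, hUT, hiso⟩ := hbir
  haveI := hiso
  have hUc : IsCompact (U : Set X) := TopologicalSpace.NoetherianSpace.isCompact _
  obtain ⟨I, X', b, r, -, hsupp, hb, -, hr⟩ := Morphisms.exists_isBlowup_dominating f U hUc
  -- `I𝒪_T ≠ 0`: a point of the dense open `f⁻¹ U` is not in `V(I𝒪_T) = f⁻¹ V(I) = f⁻¹ (X ∖ U)`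
  have hI' : I.comap f ≠ ⊥ := by
    intro h
    have h1 : ((I.comap f).support : Set T) = Set.univ := by
      rw [h, Scheme.IdealSheafData.support_bot]; rfl
    rw [Scheme.IdealSheafData.support_comap] at h1
    obtain ⟨t, ht⟩ := hUT.nonempty
    have hmem : t ∈ (TopologicalSpace.Closeds.preimage I.support f.continuous : Set T) := by
      rw [h1]; trivial
    rw [TopologicalSpace.Closeds.coe_preimage, Set.mem_preimage, hsupp] at hmem
    exact hmem ht
  haveI : IsProper r := hr.isProper
  haveI : Surjective r := ⟨(hr.isBirational' hI').surjective_of_universallyClosed⟩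
  calc topologicalKrullDim T ≤ topologicalKrullDim X' :=
      Motives.Scheme.topologicalKrullDim_le_of_universallyClosed_of_surjective r
    _ ≤ n := hb.topologicalKrullDim_le hX

/-- **The atom below the frontier: bases of dimension `≤ 3`** (TRUE modulo the printed inputs).
Let `S` be a complete regular local ring of dimension `≤ 3` and `T` integral, proper and
birational over `Spec S`, regular off the closed fibre. Then `T` is Noetherian, separated,
excellent (of finite type over the excellent complete local ring `S`) of dimension `≤ 3`
(`topologicalKrullDim_le_of_isProper_of_isBirational`). If `dim T ≤ 2`, the printed
Cossart–Jannsen–Saito theorem `hCJS` gives a `Sing T`-supported blowing up with regular source;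
if `dim T = 3`, Cossart–Piltant Thm. 1.1 (`hG`) gives a strong resolution `φ : Y → T`, an
isomorphism over `Reg T`, with `Y` integral, excellent, of dimension exactly `3` (`Y → T` is
proper and surjective, `Y → Spec S` is proper birational), so Prop. 4.4 in blow-up format
(`formatPrincipalization_dim3_of_cossartPiltant hP`) is Axiom 4 on `Y` and the format upgrade
`exists_isBlowup_supported_isRegular_of_isIso_over` yields ONE `Sing T`-supported blowing up
with regular source. In both cases the centre misses the generic point (so it is non-zero) and
lies in `Sing T`, hence over the closed point by the off-fibre regularity `hoff`.
[cite: CossartPiltant2019, Thm. 1.1 and Prop. 4.4; CossartJannsenSaito2020, Thm. 1.2] -/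
theorem stub_atomDimLeThree (p : ℕ) (hp : p.Prime)
    (hG : CossartPiltant2019General.{0}) (hP : CossartPiltant2019Principalization.{0})
    (hCJS : ∀ (X : Scheme.{0}) [IsNoetherian X] [IsReduced X], Scheme.IsExcellent X →
      topologicalKrullDim X ≤ 2 → Scheme.AdmitsDesingularization X)
    (S : Type) [CommRing S] [IsRegularLocalRing S] [CharP S p]
    [IsAdicComplete (IsLocalRing.maximalIdeal S) S] [PerfectField (IsLocalRing.ResidueField S)]
    (hdim : ringKrullDim S ≤ (3 : ℕ)) (T : Scheme.{0}) (f : T ⟶ Spec (.of S))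
    [IsIntegral T] [IsProper f] (hbir : IsBirational f)
    (hoff : ∀ t : T, f.base t ≠ IsLocalRing.closedPoint S → IsRegularLocalRing (T.presheaf.stalk t)) :
    ∃ (J : T.IdealSheafData) (T' : Scheme.{0}) (π : T' ⟶ T), J ≠ ⊥ ∧
      (∀ t : T, t ∈ J.support → f.base t = IsLocalRing.closedPoint S) ∧
      IsBlowup π J ∧ Scheme.IsRegular T' := by
  have _ := hp
  -- the base: an integral Noetherian excellent affine scheme of dimension `≤ 3`
  haveI : IsDomain S := isDomain_of_isRegularLocalRing S
  haveI : IsDomain (CommRingCat.of S) := ‹IsDomain S›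
  haveI : IsNoetherianRing (CommRingCat.of S) := (inferInstance : IsNoetherianRing S)
  have hexcS : IsExcellentRing S := isExcellentRing_of_isAdicComplete S
  have hdimS : topologicalKrullDim (Spec (.of S)) ≤ (3 : ℕ) := by
    change topologicalKrullDim (PrimeSpectrum S) ≤ _
    rw [PrimeSpectrum.topologicalKrullDim_eq_ringKrullDim]
    exact hdim
  -- `T` is Noetherian, separated, excellent, of dimension `≤ 3`
  haveI : IsLocallyNoetherian T := LocallyOfFiniteType.isLocallyNoetherian f
  haveI : CompactSpace T := QuasiCompact.compactSpace_of_compactSpace f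
  haveI : IsNoetherian T := {}
  haveI : T.IsSeparated := Scheme.isSeparated_of_isSeparated_over f
  have hexc : Scheme.IsExcellent T :=
    Picover.LocalBlowups.isExcellent_of_locallyOfFiniteType_of_isExcellentRing hexcS f
  have hdimT : topologicalKrullDim T ≤ (3 : ℕ) :=
    topologicalKrullDim_le_of_isProper_of_isBirational f hbir hdimS
  -- singular points of `T` lie over the closed point
  have hsing : ∀ t : T, t ∉ Scheme.regularLocus T → f.base t = IsLocalRing.closedPoint S :=
    fun t ht => by_contra fun h => ht (hoff t h)
  by_cases h2 : topologicalKrullDim T ≤ 2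
  · -- dimension `≤ 2`: Cossart–Jannsen–Saito
    obtain ⟨T', π, hπ⟩ := hCJS T hexc h2
    obtain ⟨J, hJ, hsupp⟩ := hπ.exists_isBlowup
    refine ⟨J, T', π, ?_, fun t ht => hsing t (hsupp ht), hJ, hπ.isRegular⟩
    rintro rfl
    have : genericPoint T ∈ ((⊥ : T.IdealSheafData).support : Set T) := by
      rw [Scheme.IdealSheafData.support_bot]; trivial
    exact hsupp this (genericPoint_mem_regularLocus T)
  · -- dimension `3`: Cossart–Piltant Thm. 1.1 + Prop. 4.4 through the format upgrade
    have hdimT3 : topologicalKrullDim T = 3 :=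
      le_antisymm (by exact_mod_cast hdimT) (Picover.LocalBlowups.three_le_of_not_le_two h2)
    obtain ⟨Y, φ, hres, W, hW, hiso⟩ := hG T hexc.isQuasiExcellent hdimT3.le
    haveI := hres.isProper
    haveI := hiso
    haveI : IsIntegral Y := by
      haveI := hres.isRegular.isReduced
      exact hres.isBirational.isIntegral
    have hgenW : genericPoint T ∈ W := by
      show genericPoint T ∈ (W : Set T)
      rw [hW]
      exact genericPoint_mem_regularLocus T
    -- `Y` is Noetherian and excellent (of finite type over `S` via `φ ≫ f`) of dimension `3`
    haveI : IsLocallyNoetherian Y := LocallyOfFiniteType.isLocallyNoetherian φ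
    haveI : CompactSpace Y := QuasiCompact.compactSpace_of_compactSpace φ
    haveI : IsNoetherian Y := {}
    have hexcY : Scheme.IsExcellent Y :=
      Picover.LocalBlowups.isExcellent_of_locallyOfFiniteType_of_isExcellentRing hexcS (φ ≫ f)
    have hdimY : topologicalKrullDim Y = 3 := by
      apply le_antisymm
      · exact_mod_cast topologicalKrullDim_le_of_isProper_of_isBirational (φ ≫ f)
          (hres.isBirational.comp hbir) hdimS
      · haveI : Surjective φ := ⟨hres.isBirational.surjective_of_universallyClosed⟩
        rw [← hdimT3]
        exact Motives.Scheme.topologicalKrullDim_le_of_universallyClosed_of_surjective φ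
    -- Axiom 4 on `Y`: Cossart–Piltant Prop. 4.4 in blow-up format
    have hA4 : ∀ I' : Y.IdealSheafData, I' ≠ ⊥ →
        ∃ (Q : Y.IdealSheafData) (Y₁ : Scheme.{0}) (σ : Y₁ ⟶ Y),
          (Q.support : Set Y) ⊆ I'.support ∧ IsBlowup σ Q ∧ Scheme.IsRegular Y₁ ∧
            IsEffectiveCartier (I'.comap σ) := fun I' hI' =>
      formatPrincipalization_dim3_of_cossartPiltant hP Y hres.isRegular hexcY hdimY I' hI'
    -- the format upgrade
    obtain ⟨Q', V'', ρ, hQ', hQ'T, hρ, hreg''⟩ :=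
      exists_isBlowup_supported_isRegular_of_isIso_over φ W hgenW hA4
    refine ⟨Q', V'', ρ, hQ', fun t ht => hsing t fun hreg => hQ'T ht ?_, hρ, hreg''⟩
    show t ∈ (W : Set T)
    rw [hW]
    exact hreg

end Summit.ResolutionOfSingularities.ResolutionOfSingularities.Theorems

end
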